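import Mathlib
import Literature.Computability.AlgebraicComplexity.ValiantClasses

/-!
# Exponential growth is not p-bounded (API for `IsPBounded`, Bürgisser 2000, Def. 2.1)

Elementary growth facts for the prelude's `IsPBounded t := ∃ c, ∀ n, t n ≤ n ^ c + c`
(`ValiantClasses.lean`): `n ↦ 2^n` is not p-bounded, a function that eventually dominates `2^n` up to a
polynomial factor is not p-bounded, and in particular the middle binomial coefficient `n ↦ C(n, ⌊n/2⌋)` is not
p-bounded (`2^n = Σ_k C(n,k) ≤ (n+1) · C(n,⌊n/2⌋)`).  These are the growth inputs that turn a fixed-`n`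
lower bound of the shape `C(n,⌊n/2⌋) ≤ m_n · ℓ_n` into the asymptotic statement "`n ↦ m_n · ℓ_n` is not
p-bounded" (used e.g. by the covering rungs of `Summits/ValiantsHypothesis`). [folklore]
[cite: Burgisser2000, Def. 2.1]
-/

namespace Literature.Computability.AlgebraicComplexity

/-- `n ↦ 2^n` is not p-bounded: at `n = 2^{2c+2}` a bound `2^n ≤ n^c + c` would force
`2^{2c+2} ≤ (2c+2)c + 1`, absurd since `c < 2^c`. [folklore] -/
theorem not_isPBounded_two_pow : ¬ IsPBounded (fun n => 2 ^ n) := by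
  rintro ⟨c, hc⟩
  have h := hc (2 ^ (2 * c + 2))
  have h1 : c < 2 ^ c := Nat.lt_two_pow_self
  have h2 : c * c < 2 ^ c * 2 ^ c := Nat.mul_lt_mul'' h1 h1
  have h3 : (2 ^ (2 * c + 2)) ^ c = 2 ^ ((2 * c + 2) * c) := by rw [← pow_mul]
  have h4 : 2 ^ c * 2 ^ c = 2 ^ (2 * c) := by rw [← pow_add]; ring_nf
  have h5 : (2 * c + 2) * c + 1 < 2 ^ (2 * c + 2) := by
    have : 2 ^ (2 * c + 2) = 4 * (2 ^ c * 2 ^ c) := by rw [h4, pow_add]; ring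
    rw [this]
    nlinarith
  have h6 : c ≤ 2 ^ ((2 * c + 2) * c) :=
    h1.le.trans (Nat.pow_le_pow_right (by norm_num) (by nlinarith))
  have h7 : 2 ^ (2 ^ (2 * c + 2)) ≤ 2 ^ ((2 * c + 2) * c + 1) := by
    calc 2 ^ (2 ^ (2 * c + 2)) ≤ (2 ^ (2 * c + 2)) ^ c + c := h
      _ = 2 ^ ((2 * c + 2) * c) + c := by rw [h3]
      _ ≤ 2 ^ ((2 * c + 2) * c) + 2 ^ ((2 * c + 2) * c) := Nat.add_le_add_left h6 _
      _ = 2 ^ ((2 * c + 2) * c + 1) := by rw [pow_succ]; ring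
  have h8 := (Nat.pow_le_pow_iff_right (le_refl 2)).1 h7
  omega

/-- A function that dominates `2^n` up to a polynomial factor from some point on is not p-bounded:
if `2^n ≤ (n+1)^k · t n` for all `n ≥ n₀` then `¬ IsPBounded t`. [folklore] -/
theorem not_isPBounded_of_two_pow_le {t : ℕ → ℕ} (k n₀ : ℕ) (h : ∀ n, n₀ ≤ n → 2 ^ n ≤ (n + 1) ^ k * t n) :
    ¬ IsPBounded t := by
  intro ht
  have hsucc : IsPBounded (fun n => n + 1) := IsPBounded.add_holds IsPBounded.id (IsPBounded.const 1)
  have hprod : IsPBounded (fun n => (n + 1) ^ k * t n) :=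
    IsPBounded.mul_holds (IsPBounded.pow_holds hsucc k) ht
  -- `2^n` is then p-bounded up to the finitely many `n < n₀`, which `IsPBounded` absorbs into the constant
  obtain ⟨c, hc⟩ := hprod
  refine not_isPBounded_two_pow ⟨c + 2 ^ n₀, fun n => ?_⟩
  have hC : 2 ^ n₀ ≤ c + 2 ^ n₀ := Nat.le_add_left _ _
  rcases Nat.eq_zero_or_pos n with rfl | hpos
  · calc 2 ^ 0 = 1 := pow_zero 2
      _ ≤ 2 ^ n₀ := Nat.one_le_two_pow
      _ ≤ c + 2 ^ n₀ := hC
      _ ≤ 0 ^ (c + 2 ^ n₀) + (c + 2 ^ n₀) := Nat.le_add_left _ _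
  · have hmono : n ^ c ≤ n ^ (c + 2 ^ n₀) := Nat.pow_le_pow_right hpos (Nat.le_add_right _ _)
    rcases Nat.lt_or_ge n n₀ with hn | hn
    · calc 2 ^ n ≤ 2 ^ n₀ := Nat.pow_le_pow_right (by norm_num) hn.le
        _ ≤ c + 2 ^ n₀ := hC
        _ ≤ n ^ (c + 2 ^ n₀) + (c + 2 ^ n₀) := Nat.le_add_left _ _
    · calc 2 ^ n ≤ (n + 1) ^ k * t n := h n hn
        _ ≤ n ^ c + c := hc n
        _ ≤ n ^ (c + 2 ^ n₀) + (c + 2 ^ n₀) := Nat.add_le_add hmono (Nat.le_add_right _ _)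

/-- The middle binomial coefficient `n ↦ C(n, ⌊n/2⌋)` is not p-bounded, since
`2^n = Σ_k C(n,k) ≤ (n+1) · C(n,⌊n/2⌋)` (every binomial coefficient is at most the middle one; the summit-side
copy of that inequality is `…ChowBorderBound.FanInTwoRung.two_pow_le_succ_mul_choose_middle`). [folklore] -/
theorem not_isPBounded_choose_middle : ¬ IsPBounded (fun n => n.choose (n / 2)) := by
  refine not_isPBounded_of_two_pow_le 1 0 fun n _ => ?_
  rw [pow_one, ← Nat.sum_range_choose n]
  calc ∑ k ∈ Finset.range (n + 1), n.choose k ≤ ∑ _k ∈ Finset.range (n + 1), n.choose (n / 2) :=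
        Finset.sum_le_sum fun k _ => Nat.choose_le_middle k n
    _ = (n + 1) * n.choose (n / 2) := by simp

end Literature.Computability.AlgebraicComplexity
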